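import Summits.ResolutionOfSingularities.ResolutionOfSingularities.Theorems.FrobeniusClosingPatchingRelPerfectDepthPhaseCContactPushforward
import Summits.ResolutionOfSingularities.ResolutionOfSingularities.Theorems.FrobeniusClosingPatchingRelPerfectDepthPhaseCContactRealisation
import Summits.ResolutionOfSingularities.ResolutionOfSingularities.Theorems.FrobeniusClosingPatchingRelPerfectDepthPhaseCContactCarrier
import Literature.AlgebraicGeometry.Resolution.EmbeddedResolutionExcellentSurfacesBoundary
import Literature.AlgebraicGeometry.Resolution.ComponentGluing
import Literature.AlgebraicGeometry.Resolution.QuasiExcellentClosedSubschemes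
import HarnessLib

/-!
# Crux `PatchingRelPerfect` (stmt-ResolutionOfSingularities-16161), chain W5.2 — F7(β) (β-AX) X3 C-I (M2b-T), (T-e): THE CONTACT TOWER —
# F-60 on the carrier, realised and pushed forward to the patch (`…DepthPhaseCContactTower`)

[OURS · L1 W5.2 · F7(β) (β-AX) X3 C-I (M2b-T) · res-L1-w52-plan-1 RULING G12-32 (iii), hand res-D-repro-1 AS res-L1-repro-3] The GEOMETRIC
HALF of `ContactCureReduction` (Sketch v20 §4.4), assembled from (T-a′) `…ContactPushforward` (p566335), (T-b) `…ContactRealisation`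
(p568017) and (T-d) `…ContactCarrier`: on the patch `Y` (regular, excellent, Noetherian) with carrier ideal `H` and member traces `BX`,
`HasSNC (H :: BX)`, and a closed subset `𝒳 ⊆ V(H)` (the contact surface), put the REDUCED induced structure on `𝒳` inside the carrier
`G = V(H)` (`(vanishingIdeal 𝒳_G).subschemeι`, reduced, range `= 𝒳_G`), feed it to the NAMED FACT F-60
`CossartJannsenSaito2020EmbeddedSequenceBoundary` (taken as a HYPOTHESIS `hF60` — statement-only Literature fact; this file is therefore a
CONDITIONAL helper, honest fact list ⟨F-60⟩) with boundary `B` = the member traces (an sncd by (T-d)), given the two remaining inputs as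
hypotheses — `dim ≤ 2` of the reduced surface and «no irreducible component inside `B`» (the 𝒳-package, owed: NF0/NF1 + K21 `dim X ≤ 4`) —,
REALISE the resulting `𝓑`-permissible sequence as a `CentreSeq` on `G` with regular centres over `closure 𝒳_G` (T-b), and PUSH it forward
along `G ↪ Y` (T-a′): **`exists_contactTower`** — a `CentreSeq` on the patch with regular centres over `𝒳`, regular top, whose last carrier
embedding is again a regular hypersurface, and along which the total transform of any `K` restricts to the carrier as `(K|_G)·𝒪`.  What the
assembly `…ContactCure` still adds on top: LEGALITY (centres over `cosupp K♭` — via (T-b′) `…ContactLegality`, res-D-pv-021, and the LEG clause)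
and END extraction ((T-c), res-D-pv-034, + (L0)).  Def-free; NOT a statement of the manuscript under review; AI-written, weaker than expert review.

## References
* V. Cossart, U. Jannsen, S. Saito, *Desingularization: Invariants and Strategy* (LNM 2270, 2020), Thm. 1.4, Def. 6.8, Thm. 6.9 (a). [CossartJannsenSaito2020]
* J. Kollár, *Lectures on Resolution of Singularities* (2007), 3.30.3, Cor. 3.85. [Kollar2007]
-/

-- `Summit.<Summit>.<Sub>.Theorems` with `Sub = Summit` (single-conjunct summit, D-0017)
set_option linter.dupNamespace false

noncomputable section

open CategoryTheory AlgebraicGeometry TopologicalSpace IsLocalRing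
open Literature.AlgebraicGeometry.Resolution
open Scheme.IdealSheafData

namespace Summit.ResolutionOfSingularities.ResolutionOfSingularities.Theorems

namespace ContactTower

universe u

variable {Y : Scheme.{u}} (H : Y.IdealSheafData) (𝒳 : Closeds Y)

/-! ## §1 The reduced contact surface inside the carrier -/

/-- [OURS · L1 W5.2 · (M2b-T) (T-e)] The reduced induced structure on the contact surface is REDUCED (F-60΄s `[IsReduced X]`). [folklore] -/
theorem isReduced_surface : IsReduced (vanishingIdeal (𝒳.preimage H.subschemeι.continuous)).subscheme :=
  ComponentGluing.isReduced_subscheme_vanishingIdeal _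

/-- [OURS · L1 W5.2 · (M2b-T) (T-e)] Its embedding has range the contact surface, read inside the carrier. [folklore] -/
theorem range_surfaceι :
    Set.range (vanishingIdeal (𝒳.preimage H.subschemeι.continuous)).subschemeι = H.subschemeι ⁻¹' (𝒳 : Set Y) := by
  rw [range_subschemeι, Scheme.IdealSheafData.coe_support_vanishingIdeal, Closeds.coe_preimage]

/-- [OURS · L1 W5.2 · (M2b-T) (T-e)] … and, pushed into the patch, the contact surface itself (when `𝒳 ⊆ V(H)`). [folklore] -/
theorem image_range_surfaceι (h𝒳 : (𝒳 : Set Y) ⊆ (H.support : Set Y)) :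
    H.subschemeι '' Set.range (vanishingIdeal (𝒳.preimage H.subschemeι.continuous)).subschemeι = (𝒳 : Set Y) := by
  rw [range_surfaceι, Set.image_preimage_eq_inter_range, range_subschemeι, Set.inter_eq_left.mpr h𝒳]

/-- The carrier of a Noetherian patch is Noetherian (F-60΄s `[IsNoetherian Z]`). [folklore] -/
theorem isNoetherian_carrier [IsNoetherian Y] : IsNoetherian H.subscheme :=
  isNoetherian_of_isClosedImmersion H.subschemeι

/-! ## §2 F-60 on the carrier, realised, pushed forward -/

variable {H 𝒳}

/-- [OURS · L1 W5.2 · F7(β) (β-AX) X3 C-I (M2b-T) (T-e)] **THE CONTACT TOWER** (conditional on the named fact F-60, taken as the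
hypothesis `hF60`): on a regular excellent Noetherian patch `Y` with carrier `H` and member traces `BX`, `HasSNC (H :: BX)`, and a closed
contact surface `𝒳` (read inside the carrier `V(H)`) whose reduced structure has dimension `≤ 2` and no irreducible component inside the boundary
(the member traces), there is a centre sequence on `Y` with REGULAR centres lying over `𝒳`, REGULAR top, last carrier embedding a regular
hypersurface (order-one kernel generators), and the total-transform rule `(K𝒪)|_{G_r} = (K|_G)𝒪_{G_r}` for every ideal sheaf `K` on `Y` —
the CJS sequence of the surface in the carrier, realised (T-b) and pushed forward (T-a′). [cite: CossartJannsenSaito2020, Thm. 1.4 (pp. 5–6)]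
[cite: Kollar2007, 3.30.3, Cor. 3.85] -/
theorem exists_contactTower [IsNoetherian Y] [DecidableEq Y.IdealSheafData] {BX : List Y.IdealSheafData}
    (hF60 : CossartJannsenSaito2020EmbeddedSequenceBoundary.{u})
    (hY : Scheme.IsRegular Y) (hYe : Scheme.IsExcellent Y) (hsnc : HasSNC (H :: BX))
    (hdim : topologicalKrullDim (vanishingIdeal (𝒳.preimage H.subschemeι.continuous)).subscheme ≤ 2)
    (hcomp : ∀ T ∈ irreducibleComponents ((vanishingIdeal (𝒳.preimage H.subschemeι.continuous)).subscheme : Type u),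
      ¬ T ⊆ (vanishingIdeal (𝒳.preimage H.subschemeι.continuous)).subschemeι ⁻¹'
        (⋃ D ∈ (BX.filter fun D => D ≠ H).map (fun D => D.comap H.subschemeι), (D.support : Set H.subscheme))) :
    ∃ t : CentreSeq Y, t.AllRegular ∧ t.CentresOver (𝒳 : Set Y) ∧ Scheme.IsRegular t.top ∧
      ∃ (tG : CentreSeq H.subscheme) (_ : t = tG.pushforward H.subschemeι),
        (∀ x ∈ (tG.pushforwardι H.subschemeι).ker.support, ∃ w : (tG.pushforward H.subschemeι).top.presheaf.stalk x,
          stalkIdeal (tG.pushforwardι H.subschemeι).ker x = Ideal.span {w} ∧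
            w ∉ (maximalIdeal ((tG.pushforward H.subschemeι).top.presheaf.stalk x)) ^ 2) ∧
        ∀ K : Y.IdealSheafData,
          (K.comap (tG.pushforward H.subschemeι).comp).comap (tG.pushforwardι H.subschemeι) = (K.comap H.subschemeι).comap tG.comp := by
  haveI : IsNoetherian H.subscheme := isNoetherian_carrier H
  haveI : IsReduced (vanishingIdeal (𝒳.preimage H.subschemeι.continuous)).subscheme := isReduced_surface H 𝒳
  obtain ⟨hGreg, hGexc, hHgen, -, hB⟩ := ContactCarrier.carrierPatch (H := H) (BX := BX) hYe hsnc
  -- F-60 on the carrier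
  obtain ⟨Z₁, π, X₁, B₁, hseq, hZ₁, -, -, -, -, -, -, -⟩ :=
    hF60 _ _ (vanishingIdeal (𝒳.preimage H.subschemeι.continuous)).subschemeι _ hGreg hGexc hdim hB hcomp
  -- realise it as a centre sequence on the carrier
  obtain ⟨tG, e, -, hreg, hover, -, -⟩ := ContactRealisation.exists_centreSeq_of_isBPermissibleSequenceB_of_isRegular hseq hZ₁
  -- the centres lie over the surface: `closure (range i) = 𝒳_G`
  have hover' : tG.CentresOver (H.subschemeι ⁻¹' (𝒳 : Set Y)) := by
    refine CentreSeq.CentresOver.mono tG ?_ hover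
    rw [range_surfaceι, (𝒳.isClosed.preimage H.subschemeι.continuous).closure_eq]
  -- push forward along the carrier embedding
  obtain ⟨h1, h2, h3⟩ := ContactPushforward.allRegular_pushforward tG H.subschemeι hY hHgen hreg
  exact ⟨tG.pushforward H.subschemeι, h1, ContactPushforward.centresOver_pushforward tG H.subschemeι _ hover', h2, tG, rfl, h3,
    fun K => ContactPushforward.comap_pushforward_comp tG H.subschemeι K⟩

end ContactTower

end Summit.ResolutionOfSingularities.ResolutionOfSingularities.Theorems

end
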